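import Summits.CriticalPhenomena.CardyFormulaZ2.Theorems.CoherentMorera.Negative.KirchhoffModes

/-!
# `CoherentMorera` (route `CardyComplexCone`, stmt-CriticalPhenomena-11388): the vertex trace of a
# Kirchhoff field is a discrete gradient; the staggered site potential — EdgePrecompact (ii) is
# load-bearing for the precompactness clause

Negative-side support for the crux `CoherentMorera` (cdisprove unit, generation 3), part 3; the frame
(`KirchhoffAt`, `potentialField`, modes `A0 … A3`, `IsZ4Character`) is part 1, `KirchhoffModes.lean`,
the non-holomorphic coherent model (covariance is load-bearing for clause 1) is part 2,
`CharacterSelectionLoadBearing.lean`.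

* `traceH`, `traceV`: the sum of the four corners of a horizontal / vertical lattice edge (one
  corner of each class, at its two endpoints) — by the corner→vertex trace identity (gen-2) the
  spin-`1/3` vertex observable of the edge is `(2cos(π/12))⁻¹` times this trace of the corner
  observable.  For a potential field the trace is a PURE DISCRETE GRADIENT:
  `(1 − i)(H_F across) + (1 + i)(H_S along)` horizontally, `(1 + i)(H_F across) + (1 − i)(H_S along)`
  vertically (`traceH_potentialField`, `traceV_potentialField`) — the lattice form of "the
  parafermion is `δ·∂Ψ`".
* The STAGGERED site potential `stagHS v = (−1)^{v₀+v₁}` with `H_F = 0`: Kirchhoff-exact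
  (`kirchhoffAt_potentialField`), EXACTLY coherent at every site with the `ℤ₄`-character `−i^{-k}`
  (`coherence_sitePotential`, `isZ4Character_neg_wtInv`), all corner moduli equal to `1`
  (`norm_sitePotential`; multiply by `δ^{1/3}` for the shape of EdgePrecompact (i)), modes
  `A₀ = A₁ = A₂ = 0`, `A₃ = −4 H_S` (`modes_stag`) — and vertex traces on two ADJACENT parallel edges
  that differ by `4(1+i)·H_S ≠ 0` (`traceH_stag`, `traceH_stag_succ`, `traceH_stag_jump`).  This is
  the planner's why-might-fail scenario "the vertex observable staggers between medial sublattices"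
  realised exactly; what excludes it is precisely the same-class equicontinuity clause (ii) of
  `EdgePrecompact` (same-class corner values at neighbouring sites differ by twice their size here),
  which is therefore LOAD-BEARING for the second clause of the crux's conclusion: clause (i) of
  EdgePrecompact together with coherence (even exact, even with a character) does not suffice.
-/

noncomputable section

open Complex
open Literature.Probability.LatticeModels

namespace Summit.CriticalPhenomena.CardyFormulaZ2.Theorems.CoherentMorera.Negative

/-! ## §F The vertex trace of a Kirchhoff field; the staggered site potential
(EdgePrecompact (ii) is load-bearing for the second clause) -/

/-- The corner trace at the HORIZONTAL lattice edge `s(x, x + e₀)`: the sum of its four corners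
(classes `0, 3` at `x`, classes `1, 2` at `x + e₀`).  By the trace identity (gen-2) the spin-`1/3`
vertex observable of that edge is `(2cos(π/12))⁻¹` times this trace of the corner observable. [folklore] -/
def traceH (E : Site 2 → Fin 4 → ℂ) (x : Site 2) : ℂ :=
  E x 0 + E (x + cornerUnit 0) 1 + E (x + cornerUnit 0) 2 + E x 3

/-- The corner trace at the VERTICAL lattice edge `s(x, x + e₁)` (classes `0, 1` at `x`, classes
`2, 3` at `x + e₁`). [folklore] -/
def traceV (E : Site 2 → Fin 4 → ℂ) (x : Site 2) : ℂ :=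
  E x 0 + E x 1 + E (x + cornerUnit 1) 2 + E (x + cornerUnit 1) 3

/-- **The vertex trace of a potential field is a pure discrete GRADIENT**: `(1 − i)`·(face potential
across the edge) `+ (1 + i)`·(site potential along the edge) — horizontal edges. [folklore] -/
theorem traceH_potentialField (HS HF : Site 2 → ℂ) (x : Site 2) :
    traceH (potentialField HS HF) x =
      (1 - I) * (HF (faceAt x 0) - HF (faceAt x 3)) + (1 + I) * (HS (x + cornerUnit 0) - HS x) := by
  simp only [traceH, potentialField, wtInv_zero, wtInv_one, wtInv_two, wtInv_three]
  rw [show faceAt (x + cornerUnit 0) 1 = faceAt x 0 from faceAt_add_unit_succ x 0,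
    show faceAt (x + cornerUnit 0) 2 = faceAt x 3 from faceAt_add_unit_add_two x 0]
  ring

/-- The same for vertical edges: `(1 + i)`·(face gradient across: `faceAt x 0` right of the edge minus
`faceAt x 1` left of it) `+ (1 − i)`·(site gradient along the edge). [folklore] -/
theorem traceV_potentialField (HS HF : Site 2 → ℂ) (x : Site 2) :
    traceV (potentialField HS HF) x =
      (1 + I) * (HF (faceAt x 0) - HF (faceAt x 1)) + (1 - I) * (HS (x + cornerUnit 1) - HS x) := by
  simp only [traceV, potentialField, wtInv_zero, wtInv_one, wtInv_two, wtInv_three]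
  rw [show faceAt (x + cornerUnit 1) 2 = faceAt x 1 from faceAt_add_unit_succ x 1,
    show faceAt (x + cornerUnit 1) 3 = faceAt x 0 from faceAt_add_unit_add_two x 1]
  ring

/-- The class vector `−i^{-k} = (−1, i, 1, −i)` is a `ℤ₄`-character (ratio `−i`). [folklore] -/
theorem isZ4Character_neg_wtInv : IsZ4Character fun k => -wtInv k := by
  refine ⟨-I, by linear_combination (I ^ 2 - 1) * Complex.I_sq, fun k => ?_⟩
  fin_cases k
  · simp
  · simp
  · simp
  · simp

/-- **A pure site potential is EXACTLY coherent with that character**: `E(v,k) = −i^{-k} H_S(v)`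
is rank one at every site, whatever `H_S` is. [folklore] -/
theorem coherence_sitePotential (HS : Site 2 → ℂ) (v : Site 2) (k k' : Fin 4) :
    (-wtInv k') * potentialField HS 0 v k - (-wtInv k) * potentialField HS 0 v k' = 0 := by
  simp only [potentialField, Pi.zero_apply]; ring

/-- Its corner values have modulus `|H_S(v)|` (so the bound clause (i) of EdgePrecompact is the bound
on `H_S`). [folklore] -/
theorem norm_sitePotential (HS : Site 2 → ℂ) (v : Site 2) (k : Fin 4) :
    ‖potentialField HS 0 v k‖ = ‖HS v‖ := by
  fin_cases k <;> simp [potentialField]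

/-- **The staggered site potential** `H_S(v) = (−1)^{v₀+v₁}` (values `±1`). [folklore] -/
def stagHS (v : Site 2) : ℂ := (((v 0 + v 1).negOnePow : ℤˣ) : ℤ)

/-- Staggering along `e₀`. [folklore] -/
theorem stagHS_add_e0 (v : Site 2) : stagHS (v + cornerUnit 0) = -stagHS v := by
  simp only [stagHS, cornerUnit, Pi.add_apply, Pi.single_eq_same, Pi.single_eq_of_ne one_ne_zero,
    add_zero]
  rw [show v 0 + 1 + v 1 = (v 0 + v 1) + 1 by ring, Int.negOnePow_succ, Units.val_neg, Int.cast_neg]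

/-- Staggering along `e₁`. [folklore] -/
theorem stagHS_add_e1 (v : Site 2) : stagHS (v + cornerUnit 1) = -stagHS v := by
  simp only [stagHS, cornerUnit, Pi.add_apply, Pi.single_eq_same, Pi.single_eq_of_ne zero_ne_one,
    add_zero]
  rw [show v 0 + (v 1 + 1) = (v 0 + v 1) + 1 by ring, Int.negOnePow_succ, Units.val_neg, Int.cast_neg]

/-- The staggered potential never vanishes. [folklore] -/
theorem stagHS_ne_zero (v : Site 2) : stagHS v ≠ 0 := by
  simp only [stagHS, ne_eq, Int.cast_eq_zero]
  exact Units.ne_zero _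

/-- **The vertex trace of the staggered model alternates at full size**: at the horizontal edge from
`x` it is `−2(1+i)·H_S(x)` … [folklore] -/
theorem traceH_stag (x : Site 2) :
    traceH (potentialField stagHS 0) x = -(2 * (1 + I)) * stagHS x := by
  rw [traceH_potentialField, stagHS_add_e0]; simp; ring

/-- … and at the next horizontal edge of the same row it is `+2(1+i)·H_S(x)`. [folklore] -/
theorem traceH_stag_succ (x : Site 2) :
    traceH (potentialField stagHS 0) (x + cornerUnit 0) = (2 * (1 + I)) * stagHS x := by
  rw [traceH_potentialField, stagHS_add_e0, stagHS_add_e0]; simp; ring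

/-- **EdgePrecompact (ii) is load-bearing for the second clause.** The staggered site potential gives
a corner field that is Kirchhoff-exact (`kirchhoffAt_potentialField`), EXACTLY coherent with a
`ℤ₄`-character (`coherence_sitePotential`, `isZ4Character_neg_wtInv`), with all corner moduli
EQUAL to `1` (`norm_sitePotential`; scale it by `δ^{1/3}` for the shape of clause (i)), but whose
vertex traces on two ADJACENT parallel lattice edges differ by `4(1+i) ≠ 0` times the common corner
size — the "vertex observable staggers between medial sublattices" scenario of the planner's
why-might-fail, realised exactly.  It violates precisely the same-class equicontinuity clause (ii)
of EdgePrecompact (same-class values at neighbouring sites differ by twice their size), which is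
therefore what excludes it: the second clause of `Conclusion` needs EdgePrecompact (ii), not only
(i) and coherence. [folklore] -/
theorem traceH_stag_jump (x : Site 2) :
    traceH (potentialField stagHS 0) (x + cornerUnit 0) - traceH (potentialField stagHS 0) x =
      4 * (1 + I) * stagHS x ∧ 4 * (1 + I) * stagHS x ≠ 0 := by
  refine ⟨by rw [traceH_stag_succ, traceH_stag]; ring, ?_⟩
  refine mul_ne_zero (mul_ne_zero (by norm_num) ?_) (stagHS_ne_zero x)
  intro h
  have := congrArg Complex.re h
  simp at this

/-- In mode language: the staggered model is carried entirely by `A₃` (`= −4 H_S`, the free mode of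
§C), with `A₀ = A₁ = A₂ = 0` — the spin-`1/3` SITE observable vanishes identically while the
vertex traces do not: site sums and edge traces see different sublattice combinations. [folklore] -/
theorem modes_stag (v : Site 2) :
    A0 (potentialField stagHS 0) v = 0 ∧ A1 (potentialField stagHS 0) v = 0 ∧
      A2 (potentialField stagHS 0) v = 0 ∧ A3 (potentialField stagHS 0) v = -4 * stagHS v := by
  refine ⟨?_, ?_, ?_, ?_⟩
  · rw [A0_potentialField]; simp
  · rw [A1_potentialField]; simp
  · rw [A2_potentialField]; simp
  · rw [A3_potentialField]; simp

end Summit.CriticalPhenomena.CardyFormulaZ2.Theorems.CoherentMorera.Negative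

end
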